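import Literature.NumberTheory.Automorphic.IntegralWeightHeckeModuleGL2
import Literature.NumberTheory.Automorphic.CompletedCohomology
import HarnessLib

/-!
# Coefficients at `p` that are trivial on the level: comparison with the arithmetic-quotient model

Topic `NumberTheory/Automorphic`; namespace `Literature.NumberTheory.Automorphic.LevelAction`.
A complement to `IntegralWeightHeckeModuleGL2` (`sectionsEquivLevelFunctions` compares the
"coefficients at `p`" model `M(U, τ)` with functions on `𝒢 ⧸ U` when `τ` extends to ALL of `𝒢`).
Here: the case where the action `τ` of the Hecke monoid `Δ` on `V` is **trivial on the level `U`**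
(but possibly non-trivial on `Δ`, e.g. the character coefficients `S(χ_m)` of
`SymPowIwahoriCoefficients` at a level `U(c,c)`, `c ≥ r`, on which `χ_m ≡ 1`).  Then

* `sectionsEquivQuotFun` — `M(U, τ) ≃ Fun(𝒢 ⧸ U, V)`, `f ↦ (gU ↦ f g)`, a `Γ`-equivariant
  isomorphism onto the coefficient module `ArithmeticQuotient.coeffRep R ι U V` of the tree's
  arithmetic-quotient model (`repIsoCoeffRep`);
* `sectionsEquivQuotFun_heckeOp` — under it the Hecke operator `[U α U]` of the level-action model is
  `E ∘ T_α`, `T_α = ArithmeticQuotient.heckeFun` the double-coset operator, whenever `τ ≡ E` on the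
  double coset `U α U` (`E = 1` for `U_v^r`, `T_w`; `E = χ_m(α)` for the diamond operators — the
  slot-`1` diamond twist); as morphisms of representations `heckeRepHom_comp_repIsoCoeffRep_hom`, and
  on cohomology `cohomologyIso`, `heckeCohomology_comp_cohomologyIso_hom`:
  **`H^i(U, τ) ≅ H^i(X_U, V)` with `[UαU] ↦ E_* ∘ T_α`.**

This identifies the target of independence of weight (`HidaIndependenceOfWeightGL2`) with the
trivial-coefficient Hida tower of `hidaControl_dominantOrdinaryPoint` (up to the diamond twist).
[KhareThorne2017, §6.4]; [Hida1994AIF, §2].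

## References

* C. Khare, J. A. Thorne, *Potential automorphy and the Leopoldt conjecture*, Amer. J. Math. 139
  (2017), §6.4 (arXiv:1409.7007, held). [KhareThorne2017]
* H. Hida, *p-adic ordinary Hecke algebras for GL(2)*, Ann. Inst. Fourier 44 (1994), §§1–2 (held).
  [Hida1994AIF]
-/

noncomputable section

open CategoryTheory

universe u

namespace Literature.NumberTheory.Automorphic.LevelAction

variable {R : Type u} [CommRing R] {Γ 𝒢 : Type u} [Group Γ] [Group 𝒢] (ι : Γ →* 𝒢)
  (Δ : Submonoid 𝒢) {V : Type u} [AddCommGroup V] [Module R V] (τ : Δ →* Module.End R V)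
  (U : Subgroup 𝒢)

/-! ### Sections trivial on the level are functions on `𝒢 ⧸ U` -/

variable {Δ τ U}

/-- A section of an action trivial on `U` is right `U`-invariant. [folklore] -/
theorem apply_mul_eq_of_mem_sections (hU : U.toSubmonoid ≤ Δ) (hτ : ∀ (u : 𝒢) (hu : u ∈ U), τ ⟨u, hU hu⟩ = 1)
    {f : 𝒢 → V} (hf : f ∈ sections Δ τ U) (g u : 𝒢) (hu : u ∈ U) : f (g * u) = f g := by
  have h := (mem_sections_iff hU).1 hf g u hu
  rwa [hτ u hu, Module.End.one_apply] at h

/-- A right `U`-invariant function is a section of an action trivial on `U`. [folklore] -/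
theorem comp_mk_mem_sections_of_trivial (hU : U.toSubmonoid ≤ Δ)
    (hτ : ∀ (u : 𝒢) (hu : u ∈ U), τ ⟨u, hU hu⟩ = 1) (F : (𝒢 ⧸ U) → V) :
    (fun g : 𝒢 => F (g : 𝒢 ⧸ U)) ∈ sections Δ τ U := by
  refine (mem_sections_iff hU).2 fun g u hu => ?_
  rw [hτ u hu, Module.End.one_apply, QuotientGroup.mk_mul_of_mem g hu]

/-- On sections, `f (gU).out = f g`. [folklore] -/
theorem apply_out_eq_of_mem_sections (hU : U.toSubmonoid ≤ Δ)
    (hτ : ∀ (u : 𝒢) (hu : u ∈ U), τ ⟨u, hU hu⟩ = 1) {f : 𝒢 → V} (hf : f ∈ sections Δ τ U) (g : 𝒢) :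
    f ((g : 𝒢 ⧸ U).out) = f g := by
  obtain ⟨u, hu⟩ := QuotientGroup.mk_out_eq_mul U g
  rw [hu, apply_mul_eq_of_mem_sections hU hτ hf g u u.2]

variable (Δ τ U) in
/-- **`M(U, τ) ≃ Fun(𝒢 ⧸ U, V)` for an action trivial on the level**: `f ↦ (gU ↦ f g)`, with inverse
`F ↦ F ∘ mk`. [cite: Hida1994AIF, §1] -/
def sectionsEquivQuotFun (hU : U.toSubmonoid ≤ Δ) (hτ : ∀ (u : 𝒢) (hu : u ∈ U), τ ⟨u, hU hu⟩ = 1) :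
    sections Δ τ U ≃ₗ[R] ((𝒢 ⧸ U) → V) where
  toFun f c := (f : 𝒢 → V) c.out
  map_add' f f' := funext fun c => rfl
  map_smul' r f := funext fun c => rfl
  invFun F := ⟨fun g => F (g : 𝒢 ⧸ U), comp_mk_mem_sections_of_trivial hU hτ F⟩
  left_inv f := Subtype.ext (funext fun g => apply_out_eq_of_mem_sections hU hτ f.2 g)
  right_inv F := funext fun c => by
    change F ((c.out : 𝒢) : 𝒢 ⧸ U) = F c
    rw [QuotientGroup.out_eq']

/-- `Φ f (gU) = f g` for every representative. [folklore] -/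
@[simp]
theorem sectionsEquivQuotFun_apply_mk (hU : U.toSubmonoid ≤ Δ)
    (hτ : ∀ (u : 𝒢) (hu : u ∈ U), τ ⟨u, hU hu⟩ = 1) (f : sections Δ τ U) (g : 𝒢) :
    sectionsEquivQuotFun Δ τ U hU hτ f (g : 𝒢 ⧸ U) = (f : 𝒢 → V) g :=
  apply_out_eq_of_mem_sections hU hτ f.2 g

/-- Unfolding lemma for the inverse. [folklore] -/
@[simp]
theorem coe_sectionsEquivQuotFun_symm_apply (hU : U.toSubmonoid ≤ Δ)
    (hτ : ∀ (u : 𝒢) (hu : u ∈ U), τ ⟨u, hU hu⟩ = 1) (F : (𝒢 ⧸ U) → V) (g : 𝒢) :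
    ((sectionsEquivQuotFun Δ τ U hU hτ).symm F : 𝒢 → V) g = F (g : 𝒢 ⧸ U) :=
  rfl

/-- **`Φ` is `Γ`-equivariant**: left translation of sections corresponds to the coefficient
representation `(γ F)(c) = F(ι(γ)⁻¹ c)` of the arithmetic-quotient model. [folklore] -/
theorem sectionsEquivQuotFun_rep (hU : U.toSubmonoid ≤ Δ)
    (hτ : ∀ (u : 𝒢) (hu : u ∈ U), τ ⟨u, hU hu⟩ = 1) (γ : Γ) (f : sections Δ τ U) :
    sectionsEquivQuotFun Δ τ U hU hτ (rep ι Δ τ U γ f) =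
      ArithmeticQuotient.coeffRepresentation R ι U V γ (sectionsEquivQuotFun Δ τ U hU hτ f) := by
  funext c
  induction c using QuotientGroup.induction_on with
  | H g =>
    rw [ArithmeticQuotient.coeffRepresentation_apply, MulAction.Quotient.smul_coe, smul_eq_mul,
      sectionsEquivQuotFun_apply_mk, sectionsEquivQuotFun_apply_mk, coe_rep_apply,
      leftTranslation_apply]

variable (Δ τ U) in
/-- **`M(U, τ) ≅ Fun(𝒢 ⧸ U, V)` as `Γ`-representations** (action trivial on the level).
[cite: Hida1994AIF, §1] -/
def repIsoCoeffRep (hU : U.toSubmonoid ≤ Δ) (hτ : ∀ (u : 𝒢) (hu : u ∈ U), τ ⟨u, hU hu⟩ = 1) :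
    Rep.of (rep ι Δ τ U) ≅ ArithmeticQuotient.coeffRep R ι U V :=
  Rep.mkIso (Representation.Equiv.mk (sectionsEquivQuotFun Δ τ U hU hτ) fun γ =>
    LinearMap.ext fun f => sectionsEquivQuotFun_rep ι hU hτ γ f)

/-- Unfolding lemma for `repIsoCoeffRep`. [folklore] -/
@[simp]
theorem repIsoCoeffRep_hom_apply (hU : U.toSubmonoid ≤ Δ)
    (hτ : ∀ (u : 𝒢) (hu : u ∈ U), τ ⟨u, hU hu⟩ = 1) (f : sections Δ τ U) :
    (repIsoCoeffRep ι Δ τ U hU hτ).hom f = sectionsEquivQuotFun Δ τ U hU hτ f :=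
  rfl

/-! ### Hecke operators: `[U α U] ↦ E ∘ T_α` -/

open scoped Classical in
/-- **Under `Φ`, `[U α U] = E ∘ T_α`** whenever `τ(y) = E` for every `y ∈ Δ` representing a coset of
`U α U / U` (`T_α = ArithmeticQuotient.heckeFun`, the double-coset operator on `Fun(𝒢 ⧸ U, V)`).
[cite: KhareThorne2017, §6.4] -/
theorem sectionsEquivQuotFun_heckeOp (hU : U.toSubmonoid ≤ Δ)
    (hτ : ∀ (u : 𝒢) (hu : u ∈ U), τ ⟨u, hU hu⟩ = 1) {α : 𝒢} (hα : α ∈ Δ) {E : Module.End R V}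
    (hE : ∀ (y : 𝒢) (hy : y ∈ Δ), (y : 𝒢 ⧸ U) ∈ ArithmeticQuotient.doubleCosetQuot U α → τ ⟨y, hy⟩ = E)
    (f : sections Δ τ U) :
    sectionsEquivQuotFun Δ τ U hU hτ (heckeOpInv hU hα f) =
      E.compLeft (𝒢 ⧸ U) (ArithmeticQuotient.heckeFun R U α V (sectionsEquivQuotFun Δ τ U hU hτ f)) := by
  funext c
  induction c using QuotientGroup.induction_on with
  | H g =>
    rw [sectionsEquivQuotFun_apply_mk, coe_heckeOpInv_apply, LinearMap.compLeft_apply,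
      Function.comp_apply]
    by_cases h : (ArithmeticQuotient.doubleCosetQuot U α).Finite
    swap
    · rw [heckeOp_eq_zero_of_infinite h, ArithmeticQuotient.heckeFun_apply, dif_neg h,
        LinearMap.zero_apply, Pi.zero_apply, map_zero]
    rw [heckeOp_eq_sum h, ArithmeticQuotient.heckeFun_apply_coe R U V α _ g h, LinearMap.sum_apply,
      Finset.sum_apply, map_sum]
    refine Finset.sum_congr rfl fun d hd => ?_
    rw [Set.Finite.mem_toFinset] at hd
    have hdΔ : d.out ∈ Δ := out_mem_of_mem_doubleCosetQuot hU hα hd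
    rw [act_of_mem hdΔ, fnAction_apply, hE _ hdΔ (by rw [QuotientGroup.out_eq']; exact hd)]
    congr 1
    have : (g : 𝒢) • d = ((g * d.out : 𝒢) : 𝒢 ⧸ U) := by
      conv_lhs => rw [← QuotientGroup.out_eq' d]
      rfl
    rw [this, sectionsEquivQuotFun_apply_mk]

/-- The same, as morphisms of representations: `[UαU] ≫ Φ = Φ ≫ T_α ≫ E_*`. [folklore] -/
theorem heckeRepHom_comp_repIsoCoeffRep_hom (hU : U.toSubmonoid ≤ Δ)
    (hτ : ∀ (u : 𝒢) (hu : u ∈ U), τ ⟨u, hU hu⟩ = 1) {α : 𝒢} (hα : α ∈ Δ) {E : Module.End R V}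
    (hE : ∀ (y : 𝒢) (hy : y ∈ Δ), (y : 𝒢 ⧸ U) ∈ ArithmeticQuotient.doubleCosetQuot U α → τ ⟨y, hy⟩ = E) :
    heckeRepHom ι Δ τ U hU hα ≫ (repIsoCoeffRep ι Δ τ U hU hτ).hom =
      (repIsoCoeffRep ι Δ τ U hU hτ).hom ≫
        (ArithmeticQuotient.heckeRepHom R U α V ι ≫ ArithmeticQuotient.coeffHom ι U E) :=
  Rep.hom_ext (Representation.IntertwiningMap.ext (LinearMap.ext fun f => by
    change sectionsEquivQuotFun Δ τ U hU hτ (heckeOpInv hU hα f) =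
      (ArithmeticQuotient.coeffHom ι U E).hom
        (ArithmeticQuotient.heckeFun R U α V (sectionsEquivQuotFun Δ τ U hU hτ f))
    rw [sectionsEquivQuotFun_heckeOp hU hτ hα hE]
    rfl))

/-! ### Cohomology -/

variable (Δ τ U) in
/-- **`H^i(U, τ) ≅ H^i(X_U, V)`**: the cohomology of the level-action model with coefficients trivial
on the level is the cohomology of the arithmetic quotient of level `U` with (trivial) coefficients
`V`. [cite: Hida1994AIF, §1] -/
def cohomologyIso (hU : U.toSubmonoid ≤ Δ) (hτ : ∀ (u : 𝒢) (hu : u ∈ U), τ ⟨u, hU hu⟩ = 1) (i : ℕ) :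
    cohomology ι Δ τ U i ≅ ArithmeticQuotient.cohomology R ι U V i :=
  (groupCohomology.functor R Γ i).mapIso (repIsoCoeffRep ι Δ τ U hU hτ)

/-- The comparison isomorphism on cohomology is the functoriality map of `repIsoCoeffRep`.
[folklore] -/
theorem cohomologyIso_hom (hU : U.toSubmonoid ≤ Δ) (hτ : ∀ (u : 𝒢) (hu : u ∈ U), τ ⟨u, hU hu⟩ = 1)
    (i : ℕ) :
    (cohomologyIso ι Δ τ U hU hτ i).hom =
      groupCohomology.map (MonoidHom.id Γ) (repIsoCoeffRep ι Δ τ U hU hτ).hom i :=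
  rfl

/-- **The Hecke operators correspond: `Φ_* ∘ [UαU] = (E_* ∘ T_α) ∘ Φ_*` on cohomology.**
[cite: KhareThorne2017, §6.4] -/
theorem heckeCohomology_comp_cohomologyIso_hom (hU : U.toSubmonoid ≤ Δ)
    (hτ : ∀ (u : 𝒢) (hu : u ∈ U), τ ⟨u, hU hu⟩ = 1) {α : 𝒢} (hα : α ∈ Δ) {E : Module.End R V}
    (hE : ∀ (y : 𝒢) (hy : y ∈ Δ), (y : 𝒢 ⧸ U) ∈ ArithmeticQuotient.doubleCosetQuot U α → τ ⟨y, hy⟩ = E)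
    (i : ℕ) :
    (cohomologyIso ι Δ τ U hU hτ i).hom.hom ∘ₗ heckeCohomology ι Δ τ U hU hα i =
      ((ArithmeticQuotient.cohomologyCoeffMap ι U E i).hom ∘ₗ ArithmeticQuotient.heckeEnd R U α V ι i) ∘ₗ
        (cohomologyIso ι Δ τ U hU hτ i).hom.hom := by
  rw [cohomologyIso_hom]
  dsimp only [heckeCohomology, ArithmeticQuotient.heckeEnd, ArithmeticQuotient.heckeOperator,
    ArithmeticQuotient.cohomologyCoeffMap]
  rw [← ModuleCat.hom_comp, ← ModuleCat.hom_comp, ← ModuleCat.hom_comp, ← groupCohomology.map_id_comp,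
    ← groupCohomology.map_id_comp, ← groupCohomology.map_id_comp,
    heckeRepHom_comp_repIsoCoeffRep_hom ι hU hτ hα hE]

/-- The untwisted case `E = 1`: `Φ_* ∘ [UαU] = T_α ∘ Φ_*` (e.g. `U_v^r`, `T_w`). [folklore] -/
theorem heckeCohomology_comp_cohomologyIso_hom_of_eq_one (hU : U.toSubmonoid ≤ Δ)
    (hτ : ∀ (u : 𝒢) (hu : u ∈ U), τ ⟨u, hU hu⟩ = 1) {α : 𝒢} (hα : α ∈ Δ)
    (hE : ∀ (y : 𝒢) (hy : y ∈ Δ), (y : 𝒢 ⧸ U) ∈ ArithmeticQuotient.doubleCosetQuot U α → τ ⟨y, hy⟩ = 1)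
    (i : ℕ) :
    (cohomologyIso ι Δ τ U hU hτ i).hom.hom ∘ₗ heckeCohomology ι Δ τ U hU hα i =
      ArithmeticQuotient.heckeEnd R U α V ι i ∘ₗ (cohomologyIso ι Δ τ U hU hτ i).hom.hom := by
  rw [heckeCohomology_comp_cohomologyIso_hom ι hU hτ hα hE i]
  congr 1
  have hco : ArithmeticQuotient.coeffHom ι U (1 : Module.End R V) = 𝟙 _ :=
    Rep.hom_ext (Representation.IntertwiningMap.ext (LinearMap.ext fun F => rfl))
  dsimp only [ArithmeticQuotient.cohomologyCoeffMap]
  rw [hco, groupCohomology.map_id, ModuleCat.hom_id, LinearMap.id_comp]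

end Literature.NumberTheory.Automorphic.LevelAction
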